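import Mathlib
import Summits.Parity.BatemanHorn.Theses.IsogenyRedei

/-!
# Sketch — first lemmas for the crux-idea cards of ideator 3 on
`Summit.Parity.BatemanHorn.Theses.IsogenyRedei.QuadraticOmegaParity` (stmt-Parity-11585).

Nothing here is proved; every `def … : Prop` is a SIGNATURE that must elaborate.
-/

namespace Summit.Parity.BatemanHorn.Cruxes.QuadraticOmegaParity.Ideator3

open scoped BigOperators
open Filter Asymptotics

/-- The crux, by name. -/
abbrev Crux : Prop := Summit.Parity.BatemanHorn.Theses.IsogenyRedei.QuadraticOmegaParity

/-- The parity sign `(−1)^{ω(f(n))}` as a real number (same junk conventions as the crux). -/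
noncomputable def sgn (f : Polynomial ℤ) (n : ℕ) : ℝ :=
  (-1 : ℝ) ^ ArithmeticFunction.cardDistinctFactors ((f.eval (n : ℤ)).toNat)

/-- AP partial sum `S_f(x; q, a) = Σ_{n ≤ x, n ≡ a (q)} (−1)^{ω(f(n))}`. -/
noncomputable def S (f : Polynomial ℤ) (q a x : ℕ) : ℝ :=
  ∑ n ∈ (Finset.Icc 1 x).filter (fun n : ℕ => n ≡ a [MOD q]), sgn f n

/-! ## Card A — affine-orbit lock / root-class peeling -/

/-- `Q1`: the `q = 1` case of the crux, for every irreducible quadratic with positive leading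
coefficient. -/
def Q1 : Prop :=
  ∀ f : Polynomial ℤ, Irreducible f → f.natDegree = 2 → 0 < f.leadingCoeff →
    (fun x : ℕ => ∑ n ∈ Finset.Icc 1 x, sgn f n) =o[atTop] fun x : ℕ => (x : ℝ)

/-- FIRST LEMMA of card A (AP-elimination by p-adic root-class peeling; provable now):
the full crux follows from its `q = 1` case taken over ALL irreducible quadratics. -/
def APElimination : Prop := Q1 → Crux

/-- Content lemma behind the peeling (provable now, elementary): for primitive (= irreducible in
`ℤ[X]`) quadratic `f` and `q ≥ 1`, every ODD prime dividing the content of `f(a + qX)` divides `q`.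
Stated through coefficients: if an odd prime `p` divides all coefficients of `f.comp (a + qX)`
then `p ∣ q`. -/
def ContentPrimesDivideModulus : Prop :=
  ∀ f : Polynomial ℤ, Irreducible f → f.natDegree = 2 → ∀ q a : ℕ, 0 < q →
    ∀ p : ℕ, p.Prime → p ≠ 2 →
      (∀ i : ℕ, (p : ℤ) ∣ (f.comp (Polynomial.C (a : ℤ) + Polynomial.C (q : ℤ) * Polynomial.X)).coeff i) →
      p ∣ q

/-- ORBIT LOCK (large sieve + Pythagoras; provable now modulo the large-sieve inequality, which is
in the tree as `Literature.NumberTheory.Sieve.large_sieve_inequality`): for `Q² ≤ x`, all but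
`η Q²` of the pairs `(q, a)`, `Q ≤ q < 2Q`, `a < q`, satisfy `|S_f(x;q,a) − S_f(x;1,0)/q| ≤ ε x / q`,
as soon as `Q ≥ Q₀(ε, η)`.  (Any bounded sequence obeys this; for the crux sequence it says the AP
family — i.e. the affine orbit `{f(a+qX)}` — is locked to its parent.) -/
def OrbitLock : Prop :=
  ∀ f : Polynomial ℤ, Irreducible f → f.natDegree = 2 → 0 < f.leadingCoeff →
    ∀ ε : ℝ, 0 < ε → ∀ η : ℝ, 0 < η → ∃ Q₀ : ℕ, ∀ Q x : ℕ, Q₀ ≤ Q → Q ^ 2 ≤ x →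
      ((((Finset.Ico Q (2 * Q)) ×ˢ (Finset.range (2 * Q))).filter
          (fun qa : ℕ × ℕ => qa.2 < qa.1 ∧
            ε * (x : ℝ) / qa.1 < |S f qa.1 qa.2 x - S f 1 0 x / qa.1|)).card : ℝ) ≤ η * (Q : ℝ) ^ 2

/-! ## Card B — Erdős–Kac + histogram shape (total variation / unimodality) -/

/-- The ω-histogram along `f` in the progression `a mod q`:
`π_j(x) = #{1 ≤ n ≤ x : n ≡ a (q), ω(f(n)) = j}`. -/
noncomputable def hist (f : Polynomial ℤ) (q a x j : ℕ) : ℕ :=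
  ((Finset.Icc 1 x).filter (fun n : ℕ => n ≡ a [MOD q] ∧
      ArithmeticFunction.cardDistinctFactors ((f.eval (n : ℤ)).toNat) = j)).card

/-- Erdős–Kac for `ω(f(n))` in arithmetic progressions, in the weak "no atom" form that follows
from Halberstam's theorem (1956): the largest cell of the histogram is `o(x)`. Theorem in print. -/
def EKNoAtom : Prop :=
  ∀ f : Polynomial ℤ, Irreducible f → f.natDegree = 2 → 0 < f.leadingCoeff → ∀ q a : ℕ, 0 < q →
    ∀ ε : ℝ, 0 < ε → ∀ᶠ x : ℕ in atTop, ∀ j : ℕ, (hist f q a x j : ℝ) ≤ ε * x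

/-- Shape hypothesis, TOTAL-VARIATION form (the transfer `C⁺` of card B): the histogram has no
unit-scale oscillation in `j`: `Σ_j |π_{j+1}(x) − π_j(x)| = o(x)`. -/
def HistSmallVariation : Prop :=
  ∀ f : Polynomial ℤ, Irreducible f → f.natDegree = 2 → 0 < f.leadingCoeff → ∀ q a : ℕ, 0 < q →
    (fun x : ℕ => ∑' j : ℕ, |(hist f q a x (j + 1) : ℝ) - hist f q a x j|) =o[atTop]
      fun x : ℕ => (x : ℝ)

/-- Shape hypothesis, UNIMODAL form (structural; with `EKNoAtom` it implies
`HistSmallVariation`). -/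
def HistUnimodal : Prop :=
  ∀ f : Polynomial ℤ, Irreducible f → f.natDegree = 2 → 0 < f.leadingCoeff → ∀ q a : ℕ, 0 < q →
    ∀ᶠ x : ℕ in atTop, ∃ m : ℕ, (∀ j : ℕ, j < m → hist f q a x j ≤ hist f q a x (j + 1)) ∧
      (∀ j : ℕ, m ≤ j → hist f q a x (j + 1) ≤ hist f q a x j)

/-- FIRST LEMMA of card B (provable now, elementary summation by parts in `j`):
small total variation of the histogram gives the crux, since
`Σ_n (−1)^{ω(f(n))} = Σ_j (−1)^j π_j(x)` and `|Σ_j (−1)^j π_j| ≤ ½ Σ_j |π_{j+1} − π_j| + π_0`. -/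
def ShapeToParity : Prop := HistSmallVariation → Crux

/-- Second lemma of card B (provable now): unimodality + no atom ⇒ small variation
(`TV ≤ 2 · max`). -/
def UnimodalToVariation : Prop := EKNoAtom → HistUnimodal → HistSmallVariation

end Summit.Parity.BatemanHorn.Cruxes.QuadraticOmegaParity.Ideator3
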